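import Literature.NumberTheory.Sieve.AsymptoticSieveForPrimesTheorem2Counting
import Literature.NumberTheory.Sieve.FriedlanderIwaniecPrimesRough
import HarnessLib

/-!
# Asymptotic sieve for primes, Theorem 2: the hypotheses of Theorem 1 for `μ²a` that do not involve the level — (B*) ≤ (2.11), (1.9) for `g̃`

Topic `Literature/NumberTheory/Sieve` (trunk T-SIEVE), sequel of `…Theorem2Counting`. Source: J. Friedlander,
H. Iwaniec, *Asymptotic sieve for primes*, Ann. of Math. 148 (1998) 1041–1065 [FriedlanderIwaniecASP1998]
(= arXiv:math/9811186), §9 p. 1061 ("Notice that `g̃(p)` satisfies (1.8) and (1.9) due to (9.1) …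
Although (B) for `𝒜` and `𝒜̃` coincide, …") and §10 (B*); [FriedlanderIwaniecAnnals1998] (2.11)–(2.12).

* `SieveSequence.moebiusSq_fiBilinearRough_le_fiBilinearPi` — `B*(ã; x, N, C, P) ≤ B_Π(a; x, N, C, P)`:
  the sieved bilinear form (B*) of [FriedlanderIwaniecASP1998] for `ã = μ²a` is bounded by the bilinear
  form (2.11) of [FriedlanderIwaniecAnnals1998] for `a` (the `m`-th inner sums agree up to the sign `μ(m)`
  for squarefree `m`, and vanish for `ã` otherwise);
* `SieveSequence.moebiusSq_hyp19` — (1.9) for `g̃` from (2.7) for `g`, (2.4) and (2.6):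
  `∑_{p≤y} g̃(p) = log log y + c̃ + O((log y)^{-10})` with `c̃ = c - ∑_p (g(p) - g̃(p))`
  (`0 ≤ g(p) - g̃(p) ≤ g(p²) ≤ K/p²`, tails `≤ K/⌊y⌋`, `(log y)^{10} ≤ 10^{10} y`);
* `SieveSequence.moebiusSq_hyp18` — (1.8) for `g̃`: `0 ≤ g̃(p) < 1`, `g̃(p) ≤ K/p`.

## References

* J. Friedlander, H. Iwaniec, *Asymptotic sieve for primes*, Ann. of Math. 148 (1998), 1041–1065,
  §9 p. 1061, §10 (B*). [cite: FriedlanderIwaniecASP1998, §9 p. 1061]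
* J. Friedlander, H. Iwaniec, *The polynomial `X² + Y⁴` captures its primes*, Ann. of Math. 148
  (1998), 945–1040, (2.7), (2.11)–(2.12). [cite: FriedlanderIwaniecAnnals1998, (2.11)-(2.12)]

## Mathlib / tree search

Tree (reused): `SieveSequence.fiBilinearRough_inner_eq` (`FriedlanderIwaniecPrimesRough`),
`fiBilinearRough`, `fiBilinearPi`, `log_pow_ten_le` (`…SquarefreeProofs`), `moebiusSq*`,
`sub_moebiusSqDensity_prime_le` (`…Theorem2Density`). Mathlib: `Summable.of_nonneg_of_le`,
`Summable.sum_add_tsum_nat_add`, `Real.tsum_le_of_sum_range_le`, `Finset.sum_range_sub'`.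
`lean search 'moebiusSq_hyp19|moebiusSq_fiBilinearRough'`: nothing before this file.
-/

noncomputable section

open Filter Finset Real
open scoped ArithmeticFunction.sigma ArithmeticFunction.Moebius

namespace Literature.NumberTheory.Sieve

open FriedlanderIwaniecPrimesSquarefree FriedlanderIwaniecPrimes

namespace SieveSequence

variable (A : SieveSequence)

/-! ### (B*) for `ã` against (2.11) for `a` -/

/-- The `m`-th inner sum of (2.11) for `ã = μ²a` is that for `a` when `m` is squarefree (for `n` coprime to
`m` with `μ(n) ≠ 0`, `mn` is squarefree), and vanishes otherwise. [folklore] -/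
theorem moebiusSq_innerPi_eq (x N C P : ℝ) (m : ℕ) :
    ∑ n ∈ (Ioc ⌊N⌋₊ ⌊2 * N⌋₊).filter
        (fun n : ℕ => ((m * n : ℕ) : ℝ) ≤ x ∧ n.Coprime m ∧ ∀ p ∈ n.primeFactors, P ≤ (p : ℝ)),
      (μ n : ℝ) * (fiGamma C n : ℝ) * A.moebiusSq.a (m * n) =
    if Squarefree m then ∑ n ∈ (Ioc ⌊N⌋₊ ⌊2 * N⌋₊).filter
        (fun n : ℕ => ((m * n : ℕ) : ℝ) ≤ x ∧ n.Coprime m ∧ ∀ p ∈ n.primeFactors, P ≤ (p : ℝ)),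
      (μ n : ℝ) * (fiGamma C n : ℝ) * A.a (m * n) else 0 := by
  split_ifs with hm
  · refine Finset.sum_congr rfl fun n hn => ?_
    have hcop : n.Coprime m := (Finset.mem_filter.mp hn).2.2.1
    by_cases hn2 : Squarefree n
    · rw [A.moebiusSq_a_of_squarefree]
      exact (Nat.squarefree_mul hcop.symm).mpr ⟨hm, hn2⟩
    · rw [ArithmeticFunction.moebius_eq_zero_of_not_squarefree hn2]; simp
  · refine Finset.sum_eq_zero fun n _ => ?_
    rw [A.moebiusSq_a_of_not_squarefree fun h => hm (Nat.squarefree_mul_iff.mp h).2.1, mul_zero]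

/-- **`B*(ã) ≤ B_Π(a)`**: the sieved bilinear form (B*) of [FriedlanderIwaniecASP1998] for `ã = μ²a`
(`SieveSequence.fiBilinearRough`) is at most the bilinear form (2.11) of [FriedlanderIwaniecAnnals1998]
for `a` (`SieveSequence.fiBilinearPi`), at the same `x, N, C, P` ("Although (B) for `𝒜` and `𝒜̃`
coincide", FI p. 1061). [cite: FriedlanderIwaniecASP1998, §9 p. 1061] -/
theorem moebiusSq_fiBilinearRough_le_fiBilinearPi (x N C P : ℝ) :
    A.moebiusSq.fiBilinearRough x N C P ≤ A.fiBilinearPi x N C P := by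
  rw [fiBilinearRough, fiBilinearPi]
  refine Finset.sum_le_sum fun m _ => ?_
  rw [fiBilinearRough_inner_eq (fun n hn => A.moebiusSq_a_of_not_squarefree hn), abs_mul,
    A.moebiusSq_innerPi_eq]
  have hμ : |(μ m : ℝ)| ≤ 1 := by exact_mod_cast ArithmeticFunction.abs_moebius_le_one
  split_ifs with hm
  · calc |(μ m : ℝ)| * _ ≤ 1 * _ := mul_le_mul_of_nonneg_right hμ (abs_nonneg _)
      _ = _ := one_mul _
  · rw [abs_zero, mul_zero]; exact abs_nonneg _

/-! ### (1.8) and (1.9) for `g̃` -/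

/-- **(1.8) for `g̃`** (FI p. 1061): `0 ≤ g̃(p) < 1` and `g̃(p) ≤ K/p` from (2.4)–(2.5) for `g`.
[cite: FriedlanderIwaniecASP1998, §9 p. 1061] -/
theorem moebiusSq_hyp18
    (h24 : ∀ p : ℕ, p.Prime → 0 ≤ A.density (p ^ 2) ∧ A.density (p ^ 2) ≤ A.density p ∧
      A.density p < 1)
    {K : ℝ} (h25 : ∀ p : ℕ, p.Prime → A.density p ≤ K / p) :
    ∀ p : ℕ, p.Prime → 0 ≤ A.moebiusSq.density p ∧ A.moebiusSq.density p < 1 ∧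
      A.moebiusSq.density p ≤ K / p := fun p hp => by
  rw [moebiusSq_density]
  exact ⟨moebiusSqDensity_prime_nonneg hp (h24 p hp), moebiusSqDensity_prime_lt_one hp (h24 p hp),
    (moebiusSqDensity_prime_le hp (h24 p hp)).trans (h25 p hp)⟩

/-- `0 ≤ g(p) - g̃(p) ≤ g(p²)` (sharper than `g(p²)/(1-g(p²))`: `g(p) - g̃(p) = g(p²)(1-g(p))/(1-g(p²))` and
`1 - g(p) ≤ 1 - g(p²)`). [folklore] -/
theorem sub_moebiusSqDensity_prime_le_sq {g : ArithmeticFunction ℝ} {p : ℕ} (hp : p.Prime)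
    (h : 0 ≤ g (p ^ 2) ∧ g (p ^ 2) ≤ g p ∧ g p < 1) :
    0 ≤ g p - moebiusSqDensity g p ∧ g p - moebiusSqDensity g p ≤ g (p ^ 2) := by
  have h1 := one_sub_sq_pos_of_hyp24 h
  have heq : g p - moebiusSqDensity g p = g (p ^ 2) * (1 - g p) / (1 - g (p ^ 2)) := by
    rw [moebiusSqDensity_prime g hp]
    field_simp
    ring
  refine ⟨sub_nonneg.mpr (moebiusSqDensity_prime_le hp h), ?_⟩
  rw [heq, div_le_iff₀ h1]
  nlinarith [h.1, h.2.1, h.2.2]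

/-- Telescoping bound for the tail of `∑ 1/n²`: `∑_{i<J} ((i+N+1)²)⁻¹ ≤ 1/N` (`N ≥ 1`). [folklore] -/
theorem sum_range_inv_sq_shift_le {N : ℕ} (hN : 1 ≤ N) (J : ℕ) :
    ∑ i ∈ range J, (((i + N + 1 : ℕ) : ℝ) ^ 2)⁻¹ ≤ 1 / N := by
  have hstep : ∀ i : ℕ, (((i + N + 1 : ℕ) : ℝ) ^ 2)⁻¹ ≤
      1 / ((i + N : ℕ) : ℝ) - 1 / ((i + 1 + N : ℕ) : ℝ) := by
    intro i
    have h0 : (0 : ℝ) < (i + N : ℕ) := by exact_mod_cast (by omega : 0 < i + N)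
    have h1 : ((i + 1 + N : ℕ) : ℝ) = (i + N : ℕ) + 1 := by push_cast; ring
    have h2 : ((i + N + 1 : ℕ) : ℝ) = (i + N : ℕ) + 1 := by push_cast; ring
    rw [h1, h2, div_sub_div _ _ h0.ne' (by linarith), inv_eq_one_div,
      div_le_div_iff₀ (by positivity) (by positivity)]
    nlinarith
  calc ∑ i ∈ range J, (((i + N + 1 : ℕ) : ℝ) ^ 2)⁻¹
      ≤ ∑ i ∈ range J, (1 / ((i + N : ℕ) : ℝ) - 1 / ((i + 1 + N : ℕ) : ℝ)) := Finset.sum_le_sum fun i _ => hstep i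
    _ = 1 / ((0 + N : ℕ) : ℝ) - 1 / ((J + N : ℕ) : ℝ) :=
        Finset.sum_range_sub' (fun i => 1 / ((i + N : ℕ) : ℝ)) J
    _ ≤ 1 / N := by
        rw [zero_add]
        have : (0 : ℝ) ≤ 1 / ((J + N : ℕ) : ℝ) := by positivity
        linarith

/-- **(1.9) for `g̃`** (FI p. 1061: "`g̃(p)` satisfies (1.8) and (1.9) due to (9.1)"): if
`∑_{p≤y} g(p) = log log y + c + O((log y)^{-10})` for `y ≥ 2` ((2.7)), and (2.4), (2.6) hold, then
`∑_{p≤y} g̃(p) = log log y + c̃ + O((log y)^{-10})` for `y ≥ 2` with `c̃ = c - ∑_p (g(p) - g̃(p))`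
(the series converging by `0 ≤ g(p) - g̃(p) ≤ g(p²) ≤ K/p²`, with tail `≤ K/⌊y⌋ ≤ 2K·10^{10}(log y)^{-10}`).
[cite: FriedlanderIwaniecASP1998, §9 p. 1061] -/
theorem moebiusSq_hyp19
    (h24 : ∀ p : ℕ, p.Prime → 0 ≤ A.density (p ^ 2) ∧ A.density (p ^ 2) ≤ A.density p ∧
      A.density p < 1)
    {K : ℝ} (h26 : ∀ p : ℕ, p.Prime → A.density (p ^ 2) ≤ K / (p : ℝ) ^ 2) {c K₉ : ℝ}
    (h27 : ∀ y : ℝ, 2 ≤ y →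
      |(∑ p ∈ Nat.primesLE ⌊y⌋₊, A.density p) - (Real.log (Real.log y) + c)| ≤ K₉ / Real.log y ^ 10) :
    ∃ c' K' : ℝ, ∀ y : ℝ, 2 ≤ y →
      |(∑ p ∈ Nat.primesLE ⌊y⌋₊, A.moebiusSq.density p) - (Real.log (Real.log y) + c')| ≤
        K' / Real.log y ^ 10 := by
  set g := A.density with hg
  have hK := hyp26_const_nonneg h24 h26
  -- the perturbation `δ`
  set δ : ℕ → ℝ := fun n => if n.Prime then g n - moebiusSqDensity g n else 0 with hδ
  have hδ0 : ∀ n, 0 ≤ δ n := fun n => by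
    simp only [hδ]; split_ifs with hn
    · exact (sub_moebiusSqDensity_prime_le_sq hn (h24 n hn)).1
    · exact le_rfl
  have hδle : ∀ n, δ n ≤ K * (((n : ℕ) : ℝ) ^ 2)⁻¹ := fun n => by
    simp only [hδ]; split_ifs with hn
    · calc g n - moebiusSqDensity g n ≤ g (n ^ 2) := (sub_moebiusSqDensity_prime_le_sq hn (h24 n hn)).2
        _ ≤ K / (n : ℝ) ^ 2 := h26 n hn
        _ = K * ((n : ℝ) ^ 2)⁻¹ := div_eq_mul_inv _ _
    · exact mul_nonneg hK (by positivity)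
  have hmaj : Summable (fun n : ℕ => K * (((n : ℕ) : ℝ) ^ 2)⁻¹) :=
    (Real.summable_nat_pow_inv.mpr one_lt_two).mul_left K
  have hδsum : Summable δ := Summable.of_nonneg_of_le hδ0 hδle hmaj
  set Tδ := ∑' n, δ n with hTδ
  refine ⟨c - Tδ, K₉ + 2 * K * 10 ^ 10, fun y hy => ?_⟩
  set N := ⌊y⌋₊ with hN
  have hy0 : 0 < y := by linarith
  have hy1 : 1 ≤ y := by linarith
  have hN2 : 2 ≤ N := Nat.le_floor (by exact_mod_cast hy)
  have hN1 : 1 ≤ N := by omega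
  have hlogy : 0 < Real.log y := Real.log_pos (by linarith)
  -- `∑_{p ≤ N} g̃(p) = ∑_{p ≤ N} g(p) - ∑_{n ≤ N} δ(n)`
  have hsplit : ∑ p ∈ Nat.primesLE N, A.moebiusSq.density p =
      ∑ p ∈ Nat.primesLE N, g p - ∑ n ∈ range (N + 1), δ n := by
    rw [moebiusSq_density, Nat.primesLE_eq_filter_range, Finset.sum_filter, Finset.sum_filter,
      ← Finset.sum_sub_distrib]
    refine Finset.sum_congr rfl fun n _ => ?_
    simp only [hδ]
    split_ifs <;> ring
  -- the tail of `∑ δ`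
  have htail_eq : ∑ n ∈ range (N + 1), δ n + ∑' n, δ (n + (N + 1)) = Tδ :=
    hδsum.sum_add_tsum_nat_add (N + 1)
  have htail0 : 0 ≤ ∑' n, δ (n + (N + 1)) := tsum_nonneg fun n => hδ0 _
  have htail : ∑' n, δ (n + (N + 1)) ≤ K * (1 / N) := by
    have hle : ∀ n, δ (n + (N + 1)) ≤ K * ((((n + N + 1 : ℕ)) : ℝ) ^ 2)⁻¹ := fun n => by
      have := hδle (n + (N + 1)); rwa [show n + (N + 1) = n + N + 1 by ring] at this ⊢
    refine Real.tsum_le_of_sum_range_le (fun n => hδ0 _) fun J => ?_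
    calc ∑ i ∈ range J, δ (i + (N + 1)) ≤ ∑ i ∈ range J, K * ((((i + N + 1 : ℕ)) : ℝ) ^ 2)⁻¹ :=
          Finset.sum_le_sum fun i _ => hle i
      _ = K * ∑ i ∈ range J, ((((i + N + 1 : ℕ)) : ℝ) ^ 2)⁻¹ := (Finset.mul_sum _ _ _).symm
      _ ≤ K * (1 / N) := mul_le_mul_of_nonneg_left (sum_range_inv_sq_shift_le hN1 J) hK
  -- `1/N ≤ 2/y ≤ 2·10^{10}/(log y)^{10}`
  have hNy : 1 / (N : ℝ) ≤ 2 * 10 ^ 10 / Real.log y ^ 10 := by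
    have hN0 : (0 : ℝ) < N := by exact_mod_cast (by omega : 0 < N)
    have hNy' : y / 2 ≤ N := by
      have := Nat.lt_floor_add_one y
      rw [← hN] at this
      linarith
    have hl10 := log_pow_ten_le hy1
    rw [div_le_div_iff₀ hN0 (pow_pos hlogy 10)]
    nlinarith
  -- assemble
  have h9 := h27 y hy
  rw [hsplit]
  have hid : ∑ p ∈ Nat.primesLE N, g p - ∑ n ∈ range (N + 1), δ n - (Real.log (Real.log y) + (c - Tδ)) =
      (∑ p ∈ Nat.primesLE N, g p - (Real.log (Real.log y) + c)) + ∑' n, δ (n + (N + 1)) := by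
    rw [← htail_eq]; ring
  rw [hid]
  refine (abs_add_le _ _).trans ?_
  rw [abs_of_nonneg htail0, add_div]
  refine add_le_add h9 (htail.trans ?_)
  calc K * (1 / (N : ℝ)) ≤ K * (2 * 10 ^ 10 / Real.log y ^ 10) := mul_le_mul_of_nonneg_left hNy hK
    _ = 2 * K * 10 ^ 10 / Real.log y ^ 10 := by ring

end SieveSequence

end Literature.NumberTheory.Sieve
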